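import Summits.Ventures.PackingBounds.Energy.CircleEnergyLP
import Summits.Ventures.PackingBounds.Energy.ChebyshevTExplicit
import Literature.Analysis.Calculus.AbsolutelyMonotonePowerSeries

/-!
# Universal optimality of the regular square (4 points on `S¹`) — Cohn–Kumar 2007, Table 1, row 1

Framing: lottery ticket; floor = certified bounds/negative ranges. Venture `PackingBounds` (cell
`pub-packcert`, seat `pub-packcert-energy`), energy-minimisation family, the `n = 2` case via the
Chebyshev LP bound `CircleLP.energy_ge` / `NewtonCert.energy_ge_circle`.

**Theorems.** Every configuration `C` of `4` unit vectors of `ℝ²` has, for every `k : ℕ`, `Σ_{x ≠ y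
∈ C} (1 + ⟨x,y⟩)^k ≥ 4 Σ_i m_i (1 + t_i)^k` (`(t_i) = (-1, 0)`, `(m_i) = (1, 2)`: the regular
square's distance distribution), hence `Σ_{x ≠ y} a(⟨x,y⟩) ≥ 4 Σ_i m_i a(t_i)` for every `a = Σ c_k
(1+t)^k`, `c_k ≥ 0`, and for every `a` with `AbsolutelyMonotoneOn a (Set.Ico (-1) 1)` (Bernstein's
theorem, `Literature.Analysis.Calculus.absolutelyMonotoneOn_hasSum_one_add`). Certificate: doubled
nodes `u = (0, 1)`, Chebyshev table `G ≥ 0` of the Newton partial products, design identities (the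
regular `4`-gon is a spherical `3`-design on `S¹`).

## References
* H. Cohn, A. Kumar, *Universally optimal distribution of points on spheres*, J. Amer. Math. Soc.
  20 (2007) 99–148, Thm. 1.2, Table 1. [`CohnKumar2006`] -/

noncomputable section

namespace Summit.Ventures.PackingBounds.Energy

open Finset Polynomial.Chebyshev Literature.Analysis.Calculus

namespace UniversalPolygon4

open scoped Classical in
/-- **Theorem A** (regular square, all `k`). [cite: CohnKumar2006, Theorem 1.2 and Table 1] -/
theorem ckPow_energy_ge (k : ℕ) (C : Finset (EuclideanSpace ℝ (Fin 2)))
    (h1 : ∀ x ∈ C, ‖x‖ = 1) (hN : C.card = 4) :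
    (4 : ℝ) * ((1 + (-1 : ℝ)) ^ k + 2 * (1 + (0 : ℝ)) ^ k) ≤
      ∑ x ∈ C, ∑ y ∈ C.erase x, (1 + inner ℝ x y) ^ k := by
  refine le_trans (le_of_eq ?val) (NewtonCert.energy_ge_circle 4 (by norm_num)
    (fun i : ℕ => match i with | 0 => (0 : ℝ) | 1 => 1 | 2 => 0 | 3 => 1 | _ => 0)
    ?hv ?hsq
    (fun j i : ℕ => match j with
      | 0 => (match i with | 0 => (1 : ℝ) | _ => 0)
      | 1 => (match i with | 0 => (1 : ℝ) | 1 => 1 | _ => 0)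
      | 2 => (match i with | 0 => (1 / 2 : ℝ) | 1 => 1 | 2 => 1 / 2 | _ => 0)
      | 3 => (match i with | 0 => (1 : ℝ) | 1 => 7 / 4 | 2 => 1 | 3 => 1 / 4 | _ => 0)
      | _ => 0)
    ?hG ?hGid 4 2 (by norm_num)
    (fun i : ℕ => match i with | 0 => (1 : ℝ) | 1 => 2 | _ => 0)
    ?hdes k C h1 hN)
  case hv => intro i; split <;> norm_num
  case hsq =>
    exact fun u _ => NewtonCert.omega_doubled_nonneg _ 2 (fun i hi => by
      interval_cases i <;> norm_num) u
  case hG =>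
    intro j i
    split <;> (first | (split <;> norm_num) | norm_num)
  case hGid =>
    intro j hj t
    interval_cases j
    · simp only [Finset.prod_range_zero, Finset.sum_range_succ, Finset.sum_range_zero, Nat.cast_zero, Nat.cast_one, Nat.cast_ofNat, ChebyshevT.t0, ChebyshevT.t1, ChebyshevT.t2, ChebyshevT.t3]
      ring
    · simp only [Finset.prod_range_succ, Finset.prod_range_zero, Finset.sum_range_succ,
        Finset.sum_range_zero, Nat.cast_zero, Nat.cast_one, Nat.cast_ofNat, ChebyshevT.t0, ChebyshevT.t1, ChebyshevT.t2, ChebyshevT.t3]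
      ring
    · simp only [Finset.prod_range_succ, Finset.prod_range_zero, Finset.sum_range_succ,
        Finset.sum_range_zero, Nat.cast_zero, Nat.cast_one, Nat.cast_ofNat, ChebyshevT.t0, ChebyshevT.t1, ChebyshevT.t2, ChebyshevT.t3]
      ring
    · simp only [Finset.prod_range_succ, Finset.prod_range_zero, Finset.sum_range_succ,
        Finset.sum_range_zero, Nat.cast_zero, Nat.cast_one, Nat.cast_ofNat, ChebyshevT.t0, ChebyshevT.t1, ChebyshevT.t2, ChebyshevT.t3]
      ring
  case hdes =>
    intro j hj
    interval_cases j <;> norm_num [Finset.prod_range_succ, Finset.prod_range_zero,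
      Finset.sum_range_succ, Finset.sum_range_zero]
  case val => norm_num [Finset.sum_range_succ, Finset.sum_range_zero]

open scoped Classical in
/-- **Theorem B** (regular square, power-series potentials). [cite: CohnKumar2006, Theorem 1.2] -/
theorem universally_optimal (a : ℝ → ℝ) (c : ℕ → ℝ) (hc : ∀ k, 0 ≤ c k)
    (ha : ∀ s : ℝ, -1 ≤ s → s < 1 → HasSum (fun k => c k * (1 + s) ^ k) (a s))
    (C : Finset (EuclideanSpace ℝ (Fin 2))) (h1 : ∀ x ∈ C, ‖x‖ = 1) (hN : C.card = 4) :
    (4 : ℝ) * (a (-1) + 2 * a (0)) ≤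
      ∑ x ∈ C, ∑ y ∈ C.erase x, a (inner ℝ x y) := by
  have key := NewtonCert.energy_ge_hasSum_of_pow (n := 2) 4 2
    (fun i : ℕ => match i with | 0 => (-1 : ℝ) | 1 => 0 | _ => 0)
    (fun i : ℕ => match i with | 0 => (1 : ℝ) | 1 => 2 | _ => 0)
    (fun i hi => by interval_cases i <;> norm_num) C h1
    (fun k => by
      have h := ckPow_energy_ge k C h1 hN
      norm_num [Finset.sum_range_succ, Finset.sum_range_zero] at h ⊢
      exact h)
    a c hc ha
  norm_num [Finset.sum_range_succ, Finset.sum_range_zero] at key ⊢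
  exact key

open scoped Classical in
/-- **Theorem C** (regular square, Cohn–Kumar Thm. 1.2 verbatim): for every `a` absolutely monotonic
on `[-1,1)`, every `4`-point configuration of unit vectors of `ℝ²` has `a`-energy at least that of
the regular square. [cite: CohnKumar2006, Theorem 1.2] -/
theorem universallyOptimal_of_absolutelyMonotoneOn (a : ℝ → ℝ)
    (ha : AbsolutelyMonotoneOn a (Set.Ico (-1) 1))
    (C : Finset (EuclideanSpace ℝ (Fin 2))) (h1 : ∀ x ∈ C, ‖x‖ = 1) (hN : C.card = 4) :
    (4 : ℝ) * (a (-1) + 2 * a (0)) ≤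
      ∑ x ∈ C, ∑ y ∈ C.erase x, a (inner ℝ x y) := by
  obtain ⟨c, hc, hsum⟩ := absolutelyMonotoneOn_hasSum_one_add ha
  exact universally_optimal a c hc hsum C h1 hN

end UniversalPolygon4

end Summit.Ventures.PackingBounds.Energy

end
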